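import Summits.ValiantsHypothesis.ValiantsHypothesis.Theorems.FifoMatchingNNDivisionHardShadowConstReadTwinEdge
import Summits.ValiantsHypothesis.ValiantsHypothesis.Theorems.FifoMatchingNNDivisionHardLocatedRowsTogetherFaceWeight

/-!
(PART 5 of 7 of the port — part 5 — §5d the twin transfer / S-top pinning (`hCOR_pinTilt`, ★★★ `pin_twin_block`, ★★★★★ `sTop_decided`); split for the 400-line cap; texts verbatim by name, docstrings added to helpers.)
# SHADOW-CONSTANT READ / TWIN ROWS — decided classes of the located law of record C′ = `ExactPencilLaw`

Theorems-side port (staged by the author val-idea-41 g3; press as `Theorems/FifoMatchingNNDivisionHardShadowConstReadTwinPin.lean`,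
`--kind proof --supports stmt-ValiantsHypothesis-21181 --as helper`) of the crux workfile `Cruxes/NNDivisionHard/ShadowConstRead41.lean`
REV 10 @72ea85f2ab68 (sha16 a021d0dfd0d83740, 1482 l., farm rc 0 / 0 sorries / 0 warnings; critic of record val-idea-crit-9 g2: WAVE-6
KEEP/KILL LIST 2026-08-29T00:50:44Z «41 g3 … `ShadowConstRead41` r1→r6 (★★★ `exactTilted_law_on_offDiagConst`, ★★★
`exactTilted_body_of_partialCommonMax`, `offDiagConst_decided`, ★★★★ `twinBlind_decided` / `interSpan_decided` / `blocks_decided` /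
`twinPCM_decided`)» KEPT; revs 7–10 (§5c–§5f) filed after the list's 00:30Z cut, graded in the wave-7 ledger).  Namespace
`Summit.ValiantsHypothesis.ValiantsHypothesis.Theorems.FifoMatching.ShadowConstRead` (parallel to `…LocatedRows`, whose frame — `T`, `RowFamily`, `three_pow_le_of_block`,
`hCOR`, `exactTilted`, `ExactPencilLaw`, `concl_of_lawBody`, `T_lt_of_block'`, `two_pow_half_mul_le` — is used BY NAME).

CONTENT: typed DECIDED CLASSES of the located law C′ (`exactTilted.Law`) in the tree's flat socket
`HasEFOfSize (corPolytope n + convexHull ℝ (Set.range q)) r → T c n < r`: shadow-constant / diagonal passengers (anchored star–clique tilt),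
partial-common-maximiser lists (junk-tolerant Kaibel–Weltge count), twin-blind / twin-PCM lists (antipodal twin rows; every span of 38 g2's
interaction matrices, so `Q_II`), and the twin transfer: a unique top — or a PCM on the top fibre — of ONE entrywise-nonnegative `S × S` pin.

HONEST LABEL: support theorems about the located LAW C′ on CLASSES of passengers, for an OPEN crux; `ExactPencilLaw` (C′), COR-VIRTUAL,
21181 `NNDivisionHard` are OPEN.  VP ≠ VNP is NOT proved here or anywhere in this tree.
-/

set_option autoImplicit false

-- the mandated summit-side namespace repeats a component by design (single-problem summit)
set_option linter.dupNamespace false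

noncomputable section

namespace Summit.ValiantsHypothesis.ValiantsHypothesis.Theorems.FifoMatching.ShadowConstRead

open Matrix Finset
open Literature.Barriers.PneNP (HasEFOfSize three_pow_le_card_mul_two_pow_of_cover_univ)
open Literature.Combinatorics.Optimization.FixedSizePsdRank (Cube bvec flat vecOuter corPolytope flat_dotProduct_vecOuter
  flat_dotProduct_le_of_mem_corPolytope)
open Summit.ValiantsHypothesis.ValiantsHypothesis.Theorems.FifoMatching.XcDivision
  (udInd udPt udRow udMat udInd_apply udInd_sq udInd_inter ud_data udRow_dotProduct_flat_diagonal flat_dotProduct_flat)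
open Summit.ValiantsHypothesis.ValiantsHypothesis.Theorems.FifoMatching.GridCorShadow (four_T_lt_two_pow)
open Summit.ValiantsHypothesis.ValiantsHypothesis.Theorems.FifoMatching.LocatedRows
  (T RowFamily three_pow_le_of_block two_pow_half_mul_le T_lt_of_block' hCOR le_hCOR exists_eq_hCOR flat_le_hCOR exactTilted ExactPencilLaw
    concl_of_lawBody CorVirtualHardN corVirtualHardN_of_exactPencilLaw sum_mul_udInd flat_dotProduct_udPt_eq flat_sub' flat_add' flat_smul')
open scoped Pointwise

section Part5
variable {k n : ℕ}

/-! §1 THE FRAME is the tree's, BY NAME: `T`, `RowFamily`, `three_pow_le_of_block`, `hCOR`, `le_hCOR`, `exists_eq_hCOR`, `flat_le_hCOR`,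
`exactTilted`, `ExactPencilLaw`, `concl_of_lawBody` (`…RowFamilies` / `…LocatedRowsColumnCoupled`), `two_pow_half_mul_le` (`…PairPencil`),
`T_lt_of_block'` (`…PinExposed`), `sum_mul_udInd` / `flat_dotProduct_udPt_eq` (`…LocatedRowsCeiling`). -/
/-! ### §5d (E21) ★★★★★ THE TWIN TRANSFER / S-TOP PINNING: a UNIQUE top of ONE nonneg `S × S`-functional decides the passenger

Add to the twin tilt a PIN `λ·P` with `P ≥ 0` entrywise, supported in `S × S` (`S = ι₂ univ`, the FIXED column part): `⟨P, x_b⟩ ≤ ⟨P, x_S⟩` for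
every clique vertex with equality on every column `c ⊇ S`, so `hCOR(−udMat(ι₂ a) + λP) = (|a|−1)² − 1 + λ⟨P, x_S⟩` (`hCOR_pinTilt`) and the
COR-slack on the face `{ι₁ b ∪ S}` is STILL the pure `(1 − |a∩b|)²` — for every `λ ≥ 0`.  If `j ↦ ⟨flat P, q_j⟩` has a UNIQUE maximiser `j⋆`
over the passenger's vertex list, then for `λ` large (`λ ≥ max ratio`, finite) `j⋆` is a COMMON maximiser of every pinned twin row, the
passenger part vanishes at `(·, j⋆)`, and the block is pure: ★★★ `pin_twin_block`, ★★★★★ `sTop_decided` (flat socket).  CONSEQUENCE: every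
passenger whose listed points have pairwise DISTINCT `S × S` blocks for some near-half `S` is decided (a generic positive `P` separates them —
genericity on paper; the kernel theorem takes `P` and `j⋆` as data).  ENEMY SPEC (E21, hereditary): for EVERY near-half split `U ⊔ S` and EVERY
nonneg `P` on `S × S`, the `P`-top value over the vertex list is attained at least TWICE — and (iterating the argument inside the top fibre,
whose `S × S` block is frozen) the `U × U`-shadows of that top fibre must themselves defeat the located law on `U`: an enemy of C′ is
HEREDITARILY TIED. -/

/-- an entrywise-nonnegative matrix supported in `S × S` reads at most its total on any clique vertex … -/
theorem flat_nonneg_dot_le (P : Matrix (Fin n) (Fin n) ℝ) (S : Finset (Fin n)) (hP0 : ∀ x y, 0 ≤ P x y)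
    (hPS : ∀ x y, P x y ≠ 0 → x ∈ S ∧ y ∈ S) (b : Finset (Fin n)) : flat P ⬝ᵥ udPt b ≤ flat P ⬝ᵥ udPt S := by
  rw [show udPt b = vecOuter n (udInd b) from rfl, show udPt S = vecOuter n (udInd S) from rfl, flat_dotProduct_vecOuter,
    flat_dotProduct_vecOuter]
  refine Finset.sum_le_sum fun x _ => Finset.sum_le_sum fun y _ => ?_
  by_cases hP : P x y = 0
  · rw [hP, zero_mul, zero_mul]
  · obtain ⟨hx, hy⟩ := hPS x y hP
    have e1 : udInd S x = 1 := by rw [udInd_apply, if_pos hx]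
    have e2 : udInd S y = 1 := by rw [udInd_apply, if_pos hy]
    rw [e1, e2, mul_one, mul_one]
    have hb1 : udInd b x * udInd b y ≤ 1 := by
      rw [udInd_apply, udInd_apply]; split_ifs <;> norm_num
    nlinarith [hP0 x y]

/-- … and exactly its total on every column containing `S`. -/
theorem flat_supported_dot_eq (P : Matrix (Fin n) (Fin n) ℝ) (S : Finset (Fin n)) (hPS : ∀ x y, P x y ≠ 0 → x ∈ S ∧ y ∈ S)
    (c : Finset (Fin n)) (hc : S ⊆ c) : flat P ⬝ᵥ udPt c = flat P ⬝ᵥ udPt S := by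
  rw [show udPt c = vecOuter n (udInd c) from rfl, show udPt S = vecOuter n (udInd S) from rfl, flat_dotProduct_vecOuter,
    flat_dotProduct_vecOuter]
  refine Finset.sum_congr rfl fun x _ => Finset.sum_congr rfl fun y _ => ?_
  by_cases hP : P x y = 0
  · rw [hP, zero_mul, zero_mul]
  · obtain ⟨hx, hy⟩ := hPS x y hP
    simp only [udInd_apply, if_pos hx, if_pos hy, if_pos (hc hx), if_pos (hc hy)]

/-- `(1 − |ι₂ a ∩ b|)² − 1 ≤ (|a| − 1)² − 1` for `|a| ≥ 2`. -/
theorem negUd_sq_le (ι₂ : Fin k ↪ Fin n) (a : Finset (Fin k)) (ha : 2 ≤ a.card) (b : Finset (Fin n)) :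
    (1 - ((a.map ι₂ ∩ b).card : ℝ)) ^ 2 - 1 ≤ ((a.card : ℝ) - 1) ^ 2 - 1 := by
  classical
  have hle : ((a.map ι₂ ∩ b).card : ℝ) ≤ a.card := by
    have := Finset.card_le_card (Finset.inter_subset_left : a.map ι₂ ∩ b ⊆ a.map ι₂)
    rw [Finset.card_map] at this
    exact_mod_cast this
  have h0 : (0 : ℝ) ≤ (a.map ι₂ ∩ b).card := Nat.cast_nonneg _
  have h2 : (2 : ℝ) ≤ a.card := by exact_mod_cast ha
  nlinarith [mul_nonneg (by linarith : (0 : ℝ) ≤ a.card + (a.map ι₂ ∩ b).card - 2)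
    (by linarith : (0 : ℝ) ≤ a.card - (a.map ι₂ ∩ b).card)]

/-- ★ the PINNED twin tilt keeps an explicit `hCOR`: `hCOR(−udMat(ι₂ a) + λP) = (|a|−1)² − 1 + λ⟨P, x_S⟩`. -/
theorem hCOR_pinTilt (ι₂ : Fin k ↪ Fin n) (a : Finset (Fin k)) (ha : 2 ≤ a.card) (P : Matrix (Fin n) (Fin n) ℝ)
    (hP0 : ∀ x y, 0 ≤ P x y)
    (hPS : ∀ x y, P x y ≠ 0 → x ∈ (Finset.univ : Finset (Fin k)).map ι₂ ∧ y ∈ (Finset.univ : Finset (Fin k)).map ι₂)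
    {lam : ℝ} (hlam : 0 ≤ lam) :
    hCOR (-udMat (a.map ι₂) + lam • P)
      = ((a.card : ℝ) - 1) ^ 2 - 1 + lam * (flat P ⬝ᵥ udPt ((Finset.univ : Finset (Fin k)).map ι₂)) := by
  classical
  set S := (Finset.univ : Finset (Fin k)).map ι₂ with hSdef
  have hval : ∀ b, flat (-udMat (a.map ι₂) + lam • P) ⬝ᵥ udPt b
      = ((1 - ((a.map ι₂ ∩ b).card : ℝ)) ^ 2 - 1) + lam * (flat P ⬝ᵥ udPt b) := by
    intro b
    rw [flat_add', flat_smul', add_dotProduct, smul_dotProduct, negUd_dot, smul_eq_mul]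
  apply le_antisymm
  · obtain ⟨b, hb⟩ := exists_eq_hCOR (-udMat (a.map ι₂) + lam • P)
    rw [← hb, hval]
    have h1 := negUd_sq_le ι₂ a ha b
    have h2 : flat P ⬝ᵥ udPt b ≤ flat P ⬝ᵥ udPt S := flat_nonneg_dot_le P S hP0 hPS b
    nlinarith [mul_le_mul_of_nonneg_left h2 hlam]
  · have h := le_hCOR (-udMat (a.map ι₂) + lam • P) S
    have hint : a.map ι₂ ∩ S = a.map ι₂ := Finset.inter_eq_left.mpr (Finset.map_subset_map.mpr (Finset.subset_univ a))
    rw [hval, hint, Finset.card_map] at h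
    have e : ((a.card : ℝ) - 1) ^ 2 = (1 - (a.card : ℝ)) ^ 2 := by ring
    rw [e]
    linarith

/-- ★★★ THE PINNED TWIN BLOCK.  If an entrywise-nonnegative `P` supported in `S × S` (`S = ι₂ univ`) has a UNIQUE maximiser `j⋆` of
`j ↦ ⟨flat P, q_j⟩` over the listed points, then ANY admissible row maxima and ANY nonnegative factorization of the exact-law located slack of
`(COR(n), q)` give `3^{k−2} ≤ (r+1)·2^{k−2}` — rows `(ι₁(a'∪{z₁,z₂}), −udMat(ι₂(a'∪{z₁,z₂})) + λ•P)` with ONE `λ = λ(q, P)`, columns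
`(ι₁ b' ∪ S, j⋆)`. -/
theorem pin_twin_block (ι₁ ι₂ : Fin k ↪ Fin n) (hι : ∀ i j, ι₁ i ≠ ι₂ j) {K r : ℕ} (q : Fin (K + 1) → (Fin (n * n) → ℝ))
    (P : Matrix (Fin n) (Fin n) ℝ) (hP0 : ∀ x y, 0 ≤ P x y)
    (hPS : ∀ x y, P x y ≠ 0 → x ∈ (Finset.univ : Finset (Fin k)).map ι₂ ∧ y ∈ (Finset.univ : Finset (Fin k)).map ι₂)
    (js : Fin (K + 1)) (htop : ∀ j, j ≠ js → flat P ⬝ᵥ q j < flat P ⬝ᵥ q js)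
    {z₁ z₂ : Fin k} (hz : z₁ ≠ z₂)
    (mrow : exactTilted.A n → ℝ) (hm1 : ∀ a j, exactTilted.ρ n a ⬝ᵥ q j ≤ mrow a)
    (hm2 : ∀ a, ∃ j, exactTilted.ρ n a ⬝ᵥ q j = mrow a)
    (U : exactTilted.A n → Option (Fin r) → ℝ) (V : Finset (Fin n) × Fin (K + 1) → Option (Fin r) → ℝ)
    (hU : ∀ a i, 0 ≤ U a i) (hV : ∀ p i, 0 ≤ V p i)
    (hfac : ∀ a b j, (exactTilted.β n a + mrow a) - exactTilted.ρ n a ⬝ᵥ (udPt b + q j) = ∑ i, U a i * V (b, j) i) :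
    3 ^ (k - 2) ≤ (r + 1) * 2 ^ (k - 2) := by
  classical
  set S := (Finset.univ : Finset (Fin k)).map ι₂ with hSdef
  set α : Finset (Fin k) := (Finset.univ.erase z₁).erase z₂ with hαdef
  have hz₂ : z₂ ∈ Finset.univ.erase z₁ := Finset.mem_erase.mpr ⟨hz.symm, Finset.mem_univ _⟩
  have hαcard : α.card = k - 2 := by
    rw [hαdef, Finset.card_erase_of_mem hz₂, Finset.card_erase_of_mem (Finset.mem_univ _), Finset.card_univ, Fintype.card_fin]
    omega
  have hαmem : ∀ x ∈ α, x ≠ z₁ ∧ x ≠ z₂ := fun x hx => by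
    simp only [hαdef, Finset.mem_erase] at hx
    exact ⟨hx.2.1, hx.1⟩
  have hz₁e : ∀ s : Finset ↥α, z₁ ∉ embα α s := fun s h => (hαmem _ (mem_of_mem_embα h)).1 rfl
  have hz₂e : ∀ s : Finset ↥α, z₂ ∉ embα α s := fun s h => (hαmem _ (mem_of_mem_embα h)).2 rfl
  let full : Finset ↥α → Finset (Fin k) := fun a' => insert z₁ (insert z₂ (embα α a'))
  have hfull_card : ∀ a', (full a').card = a'.card + 2 := fun a' => by
    have h1 : z₁ ∉ insert z₂ (embα α a') := fun h => by
      rcases Finset.mem_insert.mp h with h | h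
      · exact hz h
      · exact hz₁e a' h
    show (insert z₁ (insert z₂ (embα α a'))).card = _
    rw [Finset.card_insert_of_notMem h1, Finset.card_insert_of_notMem (hz₂e a'), card_embα]
  have hfull_inter : ∀ a' b' : Finset ↥α, full a' ∩ embα α b' = embα α (a' ∩ b') := fun a' b' => by
    show insert z₁ (insert z₂ (embα α a')) ∩ embα α b' = _
    rw [Finset.insert_inter_of_notMem (hz₁e b'), Finset.insert_inter_of_notMem (hz₂e b'), embα_inter]
  -- the pin strength λ
  let num : Finset ↥α → Fin (K + 1) → ℝ := fun a' j => twinRow ι₁ ι₂ (full a') ⬝ᵥ (q j - q js)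
  let gap : Fin (K + 1) → ℝ := fun j => flat P ⬝ᵥ q js - flat P ⬝ᵥ q j
  have hgap : ∀ j, j ≠ js → 0 < gap j := fun j hj => by
    have := htop j hj
    simp only [gap]
    linarith
  obtain ⟨lam, hlam0, hlam⟩ : ∃ lam : ℝ, 0 ≤ lam ∧ ∀ a' j, j ≠ js → num a' j ≤ lam * gap j := by
    have hne : (Finset.univ : Finset (Finset ↥α × Fin (K + 1))).Nonempty := Finset.univ_nonempty
    let f : Finset ↥α × Fin (K + 1) → ℝ := fun p => max 0 (num p.1 p.2 / gap p.2)
    refine ⟨Finset.univ.sup' hne f, ?_, ?_⟩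
    · exact le_trans (le_max_left 0 (num ∅ js / gap js)) (Finset.le_sup' f (Finset.mem_univ ((∅ : Finset ↥α), js)))
    · intro a' j hj
      have h1 : num a' j / gap j ≤ Finset.univ.sup' hne f :=
        le_trans (le_max_right 0 (num a' j / gap j)) (Finset.le_sup' f (Finset.mem_univ (a', j)))
      rwa [div_le_iff₀ (hgap j hj)] at h1
  -- rows and columns
  let row : Finset ↥α → exactTilted.A n := fun a' => ((full a').map ι₁, -udMat ((full a').map ι₂) + lam • P)
  let colset : Finset ↥α → Finset (Fin n) := fun b' => (embα α b').map ι₁ ∪ S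
  have hρ : ∀ a', exactTilted.ρ n (row a') = twinRow ι₁ ι₂ (full a') + lam • flat P := fun a' => by
    show udRow ((full a').map ι₁) + flat (-udMat ((full a').map ι₂) + lam • P)
      = udRow ((full a').map ι₁) - flat (udMat ((full a').map ι₂)) + lam • flat P
    rw [flat_add', flat_neg₄₁, flat_smul']
    abel
  have hβ : ∀ a', exactTilted.β n (row a') = 1 + hCOR (-udMat ((full a').map ι₂) + lam • P) := fun _ => rfl
  -- `j⋆` maximises every pinned row
  have hmaxrow : ∀ a' j, exactTilted.ρ n (row a') ⬝ᵥ q j ≤ exactTilted.ρ n (row a') ⬝ᵥ q js := by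
    intro a' j
    by_cases hj : j = js
    · rw [hj]
    · have h := hlam a' j hj
      simp only [num, gap, dotProduct_sub] at h
      rw [hρ, add_dotProduct, add_dotProduct, smul_dotProduct, smul_dotProduct, smul_eq_mul, smul_eq_mul]
      rw [mul_sub] at h
      linarith
  have hmax : ∀ a', exactTilted.ρ n (row a') ⬝ᵥ q js = mrow (row a') := fun a' => by
    apply le_antisymm (hm1 _ _)
    obtain ⟨j', hj'⟩ := hm2 (row a')
    rw [← hj']
    exact hmaxrow a' j'
  -- the COR part of the located slack on the block is pure
  have hcor : ∀ a' b' : Finset ↥α, exactTilted.β n (row a') - exactTilted.ρ n (row a') ⬝ᵥ udPt (colset b')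
      = (1 - ((a' ∩ b').card : ℝ)) ^ 2 := fun a' b' => by
    have hi1 : (full a').map ι₁ ∩ colset b' = (embα α (a' ∩ b')).map ι₁ := by
      show (full a').map ι₁ ∩ ((embα α b').map ι₁ ∪ (Finset.univ : Finset (Fin k)).map ι₂) = _
      rw [map_inter_col ι₁ ι₂ hι, hfull_inter]
    have hi2 : (full a').map ι₂ ∩ colset b' = (full a').map ι₂ := map_inter_col' ι₁ ι₂ hι _ _
    have hPc : flat P ⬝ᵥ udPt (colset b') = flat P ⬝ᵥ udPt S :=
      flat_supported_dot_eq P S hPS (colset b') Finset.subset_union_right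
    rw [hβ, hCOR_pinTilt ι₂ _ (by rw [hfull_card]; omega) P hP0 hPS hlam0, hρ, add_dotProduct, smul_dotProduct, smul_eq_mul,
      twinRow_dot_udPt, hi1, hi2, hPc, Finset.card_map, Finset.card_map, card_embα, hfull_card]
    push_cast
    ring
  have key := three_pow_le_of_block U V hU hV row (fun b' => (colset b', js)) (fun a' b' => ?_)
  · have h1 : Fintype.card ↥α = k - 2 := by rw [Fintype.card_coe, hαcard]
    have h2 : Fintype.card (Option (Fin r)) = r + 1 := by simp
    rw [h1, h2] at key
    exact key
  · rw [← hfac (row a') (colset b') js, dotProduct_add, hmax a']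
    have := hcor a' b'
    linarith

/-- ★★★★★ **S-TOP PINNING DECIDES** (flat socket): if some entrywise-nonnegative matrix supported in `S × S` (`S = ι₂ univ`, twins covering
all but `≤ 1` point) has a UNIQUE maximiser over the passenger's listed points, then `HasEFOfSize (COR(n) + conv q) r → T c n < r`. -/
theorem sTop_decided (c₀ : ℕ) : ∃ n₀ : ℕ, ∀ n ≥ n₀, ∀ (k : ℕ) (ι₁ ι₂ : Fin k ↪ Fin n), (∀ i j, ι₁ i ≠ ι₂ j) → n ≤ 2 * k + 1 →
    ∀ (K : ℕ) (q : Fin (K + 1) → (Fin (n * n) → ℝ)) (r : ℕ) (P : Matrix (Fin n) (Fin n) ℝ), (∀ x y, 0 ≤ P x y) →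
    (∀ x y, P x y ≠ 0 → x ∈ (Finset.univ : Finset (Fin k)).map ι₂ ∧ y ∈ (Finset.univ : Finset (Fin k)).map ι₂) →
    ∀ js : Fin (K + 1), (∀ j, j ≠ js → flat P ⬝ᵥ q j < flat P ⬝ᵥ q js) →
    HasEFOfSize (corPolytope n + convexHull ℝ (Set.range q)) r → T c₀ n < r := by
  classical
  obtain ⟨n₀, hn₀⟩ := T_lt_of_block_wide c₀
  refine ⟨max n₀ 5, fun n hn k ι₁ ι₂ hι hnk K q r P hP0 hPS js htop hR => ?_⟩
  have hn5 : 5 ≤ n := le_of_max_le_right hn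
  have hk2 : 2 ≤ k := by omega
  refine concl_of_lawBody exactTilted q (fun m hm1 hm2 U V hU hV hfac => ?_) hR
  have hz : (⟨0, by omega⟩ : Fin k) ≠ ⟨1, by omega⟩ := Fin.ne_of_val_ne (by norm_num)
  have hblock := pin_twin_block ι₁ ι₂ hι q P hP0 hPS js htop hz m hm1 hm2 U V hU hV hfac
  exact hn₀ n (le_of_max_le_left hn) (k - 2) r (by omega) hblock

end Part5

end Summit.ValiantsHypothesis.ValiantsHypothesis.Theorems.FifoMatching.ShadowConstRead
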